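import Mathlib
import Literature.NumberTheory.Automorphic.HilbertModularFormQExpansion
import Literature.NumberTheory.Automorphic.CongruenceSubgroupPropertySL2Field

/-!
# The lower unipotent law from an inversion formula (stub `stub_lower_unipotent_of_inversion` of line Sketch-ideate-r1-k1)

Stub V5 of section V (the theta seed) of line Sketch-ideate-r1-k1 for the crux
`HilbertIntegralOverconvergentIsCongruence` (stmt-Langlands-8485).  Section V shows that `Θ⁴` is a
Hilbert modular form of parallel weight `2` for `Γ₁((q))`; the weight-`2` law under the lower
unipotents `(1 0; c 1)`, `c ∈ J`, is the purely algebraic consequence, proved here for arbitrary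
functions `Φ Ψ : ℍ → ℂ`, of an inversion formula `Φ(-1/w) = C ∏_σ w_σ² Ψ(w)` on `ℍ` together with the
`J`-periodicity of `Ψ`.  Writing `z = -1/w` (`w ∈ ℍ`), the image of `SL₂(𝓞 F) → SL₂(F)` of `E₂₁(c)`
is `(1 0; σ(c) 1)` coordinatewise, `z/(σ(c) z + 1) = -1/(w - σ(c))` and
`σ(c) z + 1 = (w - σ(c))/w`; hence `Φ(z/(cz+1)) = C ∏ (w_σ - σ(c))² Ψ(w - c) = C ∏ (w_σ - σ(c))² Ψ(w)`
while `J_2((1 0; c 1), z) Φ(z) = ∏ ((w_σ - σ(c))/w_σ)² · C ∏ w_σ² Ψ(w)`, and the two agree.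
-/

set_option linter.dupNamespace false

noncomputable section

namespace Summit.Langlands.Langlands.Theorems.HilbertIntegralOverconvergentIsCongruence

open MeasureTheory Complex NumberField
open Literature.NumberTheory.Automorphic Literature.NumberTheory.Automorphic.HilbertModular
open scoped MatrixGroups

/-- The image of `E₂₁(c) ∈ SL₂(𝓞 F)` in `SL₂(F)` is `E₂₁(c)`. [folklore] -/
theorem lui_toSL2F_e21 {F : Type} [Field F] [NumberField F] (c : 𝓞 F) :
    toSL2F (SL2Rel.e21 c) = SL2Rel.e21 (c : F) :=
  SL2Rel.map_e21 _ c

/-- The denominator of the action of `E₂₁(a) = (1 0; a 1) ∈ SL₂(F)` at the embedding `σ`: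
`σ(a) z_σ + 1`. [folklore] -/
theorem lui_denom_e21 {F : Type} [Field F] (a : F) (z : Point F) (σ : F →+* ℝ) :
    denom (SL2Rel.e21 a) z σ = ((σ a : ℝ) : ℂ) * z σ + 1 := by
  simp [denom]

/-- The action of `E₂₁(a) = (1 0; a 1) ∈ SL₂(F)` at the embedding `σ`: `z_σ / (σ(a) z_σ + 1)`.
[folklore] -/
theorem lui_moeb_e21 {F : Type} [Field F] (a : F) (z : Point F) (σ : F →+* ℝ) :
    moeb (SL2Rel.e21 a) z σ = z σ / (((σ a : ℝ) : ℂ) * z σ + 1) := by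
  simp [moeb, denom]

/-- The parallel-weight-`2` automorphy factor of `E₂₁(a) = (1 0; a 1) ∈ SL₂(F)`:
`∏_σ (σ(a) z_σ + 1)²`. [folklore] -/
theorem lui_autFactor_e21 {F : Type} [Field F] [NumberField F] (a : F) (z : Point F) :
    autFactor (fun _ ↦ (2 : ℤ)) (SL2Rel.e21 a) z = ∏ σ : F →+* ℝ, (((σ a : ℝ) : ℂ) * z σ + 1) ^ 2 := by
  simp only [autFactor, lui_denom_e21, zpow_ofNat]

/-- Points of `ℍ` have non-zero coordinates. [folklore] -/
theorem lui_ne_zero_of_mem_halfSpace {F : Type} [Field F] {w : Point F} (hw : w ∈ halfSpace F)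
    (σ : F →+* ℝ) : w σ ≠ 0 := fun h ↦
  (hw σ).ne' (by rw [h, Complex.zero_im])

/-- `ℍ` is stable under `w ↦ -1/w` (coordinatewise): `Im (-1/w) = Im w / |w|²`. [folklore] -/
theorem lui_neg_inv_mem_halfSpace {F : Type} [Field F] {z : Point F} (hz : z ∈ halfSpace F) :
    (fun σ ↦ -(z σ)⁻¹) ∈ halfSpace F := fun σ ↦ by
  have h := hz σ
  simp only [Complex.neg_im, Complex.inv_im, neg_div, neg_neg]
  exact div_pos h (Complex.normSq_pos.2 (lui_ne_zero_of_mem_halfSpace hz σ))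

/-- `ℍ` is stable under real translations (coordinatewise). [folklore] -/
theorem lui_sub_real_im_pos {F : Type} [Field F] {w : Point F} (hw : w ∈ halfSpace F)
    (r : (F →+* ℝ) → ℝ) (σ : F →+* ℝ) : 0 < (w σ - (r σ : ℂ)).im := by
  simpa only [Complex.sub_im, Complex.ofReal_im, sub_zero] using hw σ

/-- The heart of stub V5, at the point `z = -1/w`, `w ∈ ℍ`, for the matrix `E₂₁(a) ∈ SL₂(F)`:
if `Φ(-1/w) = C ∏_σ w_σ² Ψ(w)` on `ℍ` and `Ψ(w + a) = Ψ(w)` on `ℍ`, then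
`Φ(E₂₁(a) z) = J_2(E₂₁(a), z) Φ(z)`.  Indeed `E₂₁(a) z = -1/(w - a)`, `σ(a) z_σ + 1 = (w_σ - σ(a))/w_σ`,
so both sides equal `C ∏_σ (w_σ - σ(a))² Ψ(w)`. [folklore] -/
theorem lui_law_e21_at_neg_inv {F : Type} [Field F] [NumberField F] (Φ Ψ : Point F → ℂ) (C : ℂ)
    (a : F) (hinv : ∀ w ∈ halfSpace F, Φ (fun σ ↦ -(w σ)⁻¹) = C * (∏ σ : F →+* ℝ, w σ ^ 2) * Ψ w)
    (hper : ∀ w ∈ halfSpace F, Ψ (fun σ ↦ w σ + ((σ a : ℝ) : ℂ)) = Ψ w) {w : Point F}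
    (hw : w ∈ halfSpace F) :
    Φ (moeb (SL2Rel.e21 a) fun σ ↦ -(w σ)⁻¹) =
      autFactor (fun _ ↦ (2 : ℤ)) (SL2Rel.e21 a) (fun σ ↦ -(w σ)⁻¹) * Φ fun σ ↦ -(w σ)⁻¹ := by
  have hw0 : ∀ σ, w σ ≠ 0 := lui_ne_zero_of_mem_halfSpace hw
  -- the translate `w' = w - a` lies in `ℍ`
  have him' : ∀ σ, 0 < (w σ - ((σ a : ℝ) : ℂ)).im := lui_sub_real_im_pos hw fun σ ↦ σ a
  have hw' : (fun σ ↦ w σ - ((σ a : ℝ) : ℂ)) ∈ halfSpace F := him'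
  -- the denominator at `z = -1/w`: `σ(a) z_σ + 1 = (w_σ - σ(a)) / w_σ`
  have hkey : ∀ σ, ((σ a : ℝ) : ℂ) * -(w σ)⁻¹ + 1 = (w σ - ((σ a : ℝ) : ℂ)) / w σ := fun σ ↦ by
    rw [sub_div, div_self (hw0 σ), div_eq_mul_inv]
    ring
  -- (i) the Möbius image of `-1/w` under `(1 0; a 1)` is `-1/(w - a)`
  have hmoeb : (moeb (SL2Rel.e21 a) fun σ ↦ -(w σ)⁻¹) = fun σ ↦ -(w σ - ((σ a : ℝ) : ℂ))⁻¹ := by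
    funext σ
    simp only [lui_moeb_e21]
    rw [hkey σ, div_div_eq_mul_div, neg_mul, inv_mul_cancel₀ (hw0 σ), neg_div, one_div]
  -- (ii) the automorphy factor at `-1/w` is `∏ ((w - a)/w)²`
  have haut : autFactor (fun _ ↦ (2 : ℤ)) (SL2Rel.e21 a) (fun σ ↦ -(w σ)⁻¹) =
      ∏ σ : F →+* ℝ, ((w σ - ((σ a : ℝ) : ℂ)) / w σ) ^ 2 := by
    simp only [lui_autFactor_e21]
    exact Finset.prod_congr rfl fun σ _ ↦ by rw [hkey σ]
  -- (iii) `Ψ(w - a) = Ψ(w)` by periodicity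
  have hΨ : Ψ (fun σ ↦ w σ - ((σ a : ℝ) : ℂ)) = Ψ w := by
    have h := hper _ hw'
    simp only [sub_add_cancel] at h
    exact h.symm
  -- (iv) the products match: `∏ ((w - a)/w)² ∏ w² = ∏ (w - a)²`
  have hprod : (∏ σ : F →+* ℝ, ((w σ - ((σ a : ℝ) : ℂ)) / w σ) ^ 2) * ∏ σ : F →+* ℝ, w σ ^ 2 =
      ∏ σ : F →+* ℝ, (w σ - ((σ a : ℝ) : ℂ)) ^ 2 := by
    rw [← Finset.prod_mul_distrib]
    refine Finset.prod_congr rfl fun σ _ ↦ ?_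
    rw [← mul_pow, div_mul_cancel₀ _ (hw0 σ)]
  rw [hmoeb, hinv _ hw', haut, hinv w hw, hΨ, ← hprod]
  ring

/-- **stub V5 — `stub_lower_unipotent_of_inversion` (M; the lower unipotent law from an inversion formula).** If `Φ(-1/w) = C ∏_σ w_σ² Ψ(w)`
on `ℍ` and `Ψ` is `J`-periodic on `ℍ`, then `Φ` satisfies the parallel-weight-`2` law under `(1 0; c 1)`, `c ∈ J`:
`z/(cz+1) = -1/w'` with `w' = -1/z - c`, so `Φ(z/(cz+1)) = C ∏ w'_σ² Ψ(-1/z) = ∏ (w'_σ z_σ)² Φ(z) = ∏(σ(c)z_σ + 1)² Φ(z)` (if `C = 0` both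
sides vanish). [folklore] -/
theorem stub_lower_unipotent_of_inversion (F : Type) [Field F] [NumberField F] (Φ Ψ : Point F → ℂ) (C : ℂ) (J : Ideal (𝓞 F))
    (hinv : ∀ w ∈ halfSpace F, Φ (fun σ ↦ -(w σ)⁻¹) = C * (∏ σ : F →+* ℝ, w σ ^ 2) * Ψ w)
    (hper : ∀ c ∈ J, ∀ w ∈ halfSpace F, Ψ (fun σ ↦ w σ + ((σ (c : F) : ℝ) : ℂ)) = Ψ w) :
    ∀ c ∈ J, ∀ z ∈ halfSpace F,
      Φ (moeb (toSL2F (SL2Rel.e21 c)) z) = autFactor (fun _ ↦ (2 : ℤ)) (toSL2F (SL2Rel.e21 c)) z * Φ z := by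
  intro c hc z hz
  -- `z = -1/w` with `w = -1/z ∈ ℍ`
  have hzw : z = fun σ ↦ -((fun τ ↦ -(z τ)⁻¹) σ)⁻¹ := funext fun σ ↦ by simp
  rw [lui_toSL2F_e21, hzw]
  exact lui_law_e21_at_neg_inv Φ Ψ C (c : F) hinv (hper c hc) (lui_neg_inv_mem_halfSpace hz)

end Summit.Langlands.Langlands.Theorems.HilbertIntegralOverconvergentIsCongruence
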